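import Literature.Probability.Percolation.QSMPolynomials

/-!
# `CriticalCurveRegular` (crux stmt-CriticalPhenomena-16065), line `locmod`, stub 5
# (`stub_twoClassShear`, the abstract two-class Aizenman–Grimmett shear): the window-SIZE bound is
# load-bearing

Negative / tightness lemma from the crux disprover (nothing here asserts the crux or a stub).

In the registered stub the constant is `C = μ₀^{-N} 2^N N`, where `N` bounds BOTH the window sizes
`|Cw e|` and the overlaps `#{e ∈ KV : f ∈ Cw e}`. If the window-size hypothesis is dropped (so `N`
only bounds the overlap), the conclusion `gTheta(q(p,t)) ≤ gTheta(q(p + Ch, t - h))` is FALSE: on four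
coordinates, `KV = {0}` (parameter `t`), `KH = {1,2,3}` (parameter `p`), increasing event
`A = {S | 0 ∈ S ∨ {1,2,3} ⊆ S}`, window `Cw 0 =` everything, `N = 1`, `μ₀ = 1/4`, all remaining
hypotheses hold (the local modification sends any configuration to `{2,3}`, in which `1` is pivotal),
but at `(p,t,h) = (1/4, 3/4, 1/64)` (so `C = 8`, `p + Ch = 3/8`, `t - h = 47/64`) the event probability
`t + (1-t)p³` DROPS: `3/4 + 1/256 > 47/64 + (17/64)(3/8)³`. So any proof of the stub must use the
window-size bound: the Aizenman–Grimmett constant necessarily grows with the window.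
-/

namespace Summit.CriticalPhenomena.PercolationContinuityZ3.Theorems.CriticalCurveRegular.Negative

open Literature.Probability.Percolation

/-- The model event `{S | 0 ∈ S ∨ {1,2,3} ⊆ S}` on `Fin 4` is increasing. [folklore] -/
theorem isUpperSet_shearModel :
    IsUpperSet {S : Set (Fin 4) | (0 : Fin 4) ∈ S ∨ ((1 : Fin 4) ∈ S ∧ (2 : Fin 4) ∈ S ∧ (3 : Fin 4) ∈ S)} := by
  intro S T hST hS
  rcases hS with h | ⟨h1, h2, h3⟩
  · exact Or.inl (hST h)
  · exact Or.inr ⟨hST h1, hST h2, hST h3⟩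

/-- `univ : Finset (Fin 4)` as an explicit insert-chain (for powerset enumeration). [folklore] -/
theorem univ_fin4_eq : (Finset.univ : Finset (Fin 4)) = {0, 1, 2, 3} := by decide

/-- Closed form of the model polynomial: with parameter `t` on `{0}` and `p` on `{1,2,3}`,
`gTheta univ A q = t + (1 - t) p³` (`= P(0 open ∨ 1,2,3 open)`). [folklore] -/
theorem gTheta_shearModel (p t : ℝ) :
    ProdWeight.gTheta (Finset.univ : Finset (Fin 4))
      {S : Set (Fin 4) | (0 : Fin 4) ∈ S ∨ ((1 : Fin 4) ∈ S ∧ (2 : Fin 4) ∈ S ∧ (3 : Fin 4) ∈ S)}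
      (fun i : Fin 4 => if i ∈ ({0} : Finset (Fin 4)) then t
        else if i ∈ ({1, 2, 3} : Finset (Fin 4)) then p else 0) = t + (1 - t) * p ^ 3 := by
  unfold ProdWeight.gTheta ProdWeight.gW
  simp only [Fin.prod_univ_four]
  rw [univ_fin4_eq]
  rw [Finset.sum_powerset_insert (by decide), Finset.sum_powerset_insert (by decide),
    Finset.sum_powerset_insert (by decide), Finset.sum_powerset_insert (by decide),
    Finset.sum_powerset_insert (by decide), Finset.sum_powerset_insert (by decide),
    Finset.sum_powerset_insert (by decide)]
  rw [← Finset.insert_empty]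
  iterate 8 rw [Finset.sum_powerset_insert (by decide)]
  simp only [Finset.powerset_empty, Finset.sum_singleton]
  simp [ProdWeight.gwt]
  ring

/-- In the model, the horizontal coordinate `1` is pivotal in the configuration `{2,3}`. [folklore] -/
theorem isPivotal_one_pair_shearModel :
    IsPivotal {S : Set (Fin 4) | (0 : Fin 4) ∈ S ∨ ((1 : Fin 4) ∈ S ∧ (2 : Fin 4) ∈ S ∧ (3 : Fin 4) ∈ S)}
      (1 : Fin 4) (↑({2, 3} : Finset (Fin 4)) : Set (Fin 4)) := by
  rw [ProdWeight.isPivotal_iff_of_upper isUpperSet_shearModel]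
  constructor
  · right
    simp
  · intro hmem
    rcases hmem with h0 | ⟨h1, -, -⟩
    · simp at h0
    · simp at h1

/-- **The window-size bound of `stub_twoClassShear` is load-bearing.** The stub's statement with the
hypothesis `(∀ e ∈ KV, (Cw e).card ≤ N)` deleted (everything else verbatim) is FALSE, by the
four-coordinate model of the file header. [folklore] -/
theorem twoClassShear_false_without_windowBound :
    ¬ (∀ (ι : Type) [DecidableEq ι] (K KV KH : Finset ι) (A : Set (Set ι)) (Cw : ι → Finset ι)
        (N : ℕ) (μ₀ : ℝ),
        IsUpperSet A → KV ⊆ K → KH ⊆ K → Disjoint KV KH →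
        (∀ f ∈ KH, (KV.filter fun e => f ∈ Cw e).card ≤ N) →
        (∀ e ∈ KV, ∀ S : Finset ι, S ⊆ KV ∪ KH → IsPivotal A e (↑S : Set ι) →
          ∃ S' : Finset ι, S' ⊆ KV ∪ KH ∧ (∃ f ∈ KH, f ∈ Cw e ∧ IsPivotal A f (↑S' : Set ι)) ∧
            ∀ i, i ∉ Cw e → (i ∈ S ↔ i ∈ S')) →
        0 < μ₀ → μ₀ ≤ 1 / 2 →
        ∀ p t h : ℝ, 0 ≤ h → μ₀ ≤ p → p + (μ₀ ^ N)⁻¹ * 2 ^ N * (N : ℝ) * h ≤ 1 - μ₀ →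
          μ₀ ≤ t - h → t ≤ 1 - μ₀ →
          ProdWeight.gTheta K A (fun i => if i ∈ KV then t else if i ∈ KH then p else 0) ≤
            ProdWeight.gTheta K A (fun i => if i ∈ KV then t - h
              else if i ∈ KH then p + (μ₀ ^ N)⁻¹ * 2 ^ N * (N : ℝ) * h else 0)) := by
  intro h
  have hmod : ∀ e ∈ ({0} : Finset (Fin 4)), ∀ S : Finset (Fin 4), S ⊆ {0} ∪ {1, 2, 3} →
      IsPivotal {S : Set (Fin 4) | (0 : Fin 4) ∈ S ∨ ((1 : Fin 4) ∈ S ∧ (2 : Fin 4) ∈ S ∧ (3 : Fin 4) ∈ S)}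
        e (↑S : Set (Fin 4)) →
      ∃ S' : Finset (Fin 4), S' ⊆ {0} ∪ {1, 2, 3} ∧
        (∃ f ∈ ({1, 2, 3} : Finset (Fin 4)), f ∈ (fun _ : Fin 4 => (Finset.univ : Finset (Fin 4))) e ∧
          IsPivotal {S : Set (Fin 4) | (0 : Fin 4) ∈ S ∨ ((1 : Fin 4) ∈ S ∧ (2 : Fin 4) ∈ S ∧ (3 : Fin 4) ∈ S)}
            f (↑S' : Set (Fin 4))) ∧
        ∀ i, i ∉ (fun _ : Fin 4 => (Finset.univ : Finset (Fin 4))) e → (i ∈ S ↔ i ∈ S') := by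
    intro e _ S _ _
    exact ⟨{2, 3}, by decide, ⟨1, by decide, Finset.mem_univ _, isPivotal_one_pair_shearModel⟩,
      fun i hi => absurd (Finset.mem_univ i) hi⟩
  have hover : ∀ f ∈ ({1, 2, 3} : Finset (Fin 4)),
      (({0} : Finset (Fin 4)).filter fun e => f ∈ (fun _ : Fin 4 => (Finset.univ : Finset (Fin 4))) e).card
        ≤ 1 := by
    intro f _
    exact (Finset.card_filter_le _ _).trans (by simp)
  have key := h (Fin 4) Finset.univ {0} {1, 2, 3}
    {S : Set (Fin 4) | (0 : Fin 4) ∈ S ∨ ((1 : Fin 4) ∈ S ∧ (2 : Fin 4) ∈ S ∧ (3 : Fin 4) ∈ S)}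
    (fun _ => Finset.univ) 1 (1 / 4)
    isUpperSet_shearModel (Finset.subset_univ _) (Finset.subset_univ _) (by decide) hover hmod
    (by norm_num) (by norm_num) (1 / 4) (3 / 4) (1 / 64) (by norm_num) (by norm_num) (by norm_num)
    (by norm_num) (by norm_num)
  rw [gTheta_shearModel, gTheta_shearModel] at key
  norm_num at key

end Summit.CriticalPhenomena.PercolationContinuityZ3.Theorems.CriticalCurveRegular.Negative
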